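import Mathlib
import Summits.Ventures.PercRepro2.A3PendantO
import Summits.Ventures.PercRepro2.A3PendantB
import Summits.Ventures.PercRepro2.A3PendantRoot

/-!
# (MEANS-a₃) for `a₃` a leaf at ANY MARK — the pendant-at-a-mark class of `A3Between` in one statement
(blind cell PercRepro2, night-1 g30; proofs/NIGHT1-G30.md §5 — NIGHT1-G29.md §5.3 in the kernel)

`A3Between_pendant_mark`: if `a₃` is a leaf attached by `f` to a vertex `x ∈ {o, b, a₁, a₂}`, then
(MEANS-a₃) holds at every weight of the leaf edge — by `A3Between_pendant_o`, `A3Between_pendant_b`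
and `A3Between_pendant_root`.  With `A3FibreMain.HCov_of_a3Between` this re-derives (HCOV) on the
class (known: HMFPendantO / HMFPendantB / HMFPendantRoot); the point is the REDUCED statement.
Standard axioms.
-/

namespace Summit.Ventures.PercRepro2

open UnionCluster CovForm

namespace CovForm

namespace A3Fibre

variable {V : Type*} {E : Type*} [Fintype V] [DecidableEq V] [Fintype E] [DecidableEq E]
  {R : Type*} [Field R] [LinearOrder R] [IsStrictOrderedRing R]
  {ends : E → Sym2 V} {f : E} {a₃ : V}

/-- **(MEANS-a₃) for `a₃` a leaf at any mark, at every weight of the leaf edge.** -/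
theorem A3Between_pendant_mark {p : E → R} (hp : IsProbVec p) {o a₁ a₂ b x : V}
    (hf : ends f = s(a₃, x)) (hleaf : ∀ e, a₃ ∈ ends e → e = f)
    (hx : x = o ∨ x = b ∨ x = a₁ ∨ x = a₂) (h31 : a₃ ≠ a₁) (h32 : a₃ ≠ a₂) (ho : o ≠ a₃)
    (hb : b ≠ a₃) : A3Between p ends o a₁ a₂ a₃ b := by
  rcases hx with rfl | rfl | rfl | rfl
  · exact A3Between_pendant_o hp hf hleaf (Ne.symm ho) h31 h32 hb
  · exact A3Between_pendant_b hp hf hleaf (Ne.symm hb) h31 h32 ho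
  · exact A3Between_pendant_root hp (Or.inl hf) hleaf h31 h32 o b
  · exact A3Between_pendant_root hp (Or.inr hf) hleaf h31 h32 o b

/-- **(HCOV) for `a₃` a leaf at any mark**, through the reduced statement. -/
theorem HCov_pendant_mark_of_a3Between {p : E → R} (hp : IsProbVec p) {o a₁ a₂ b x : V}
    (hf : ends f = s(a₃, x)) (hleaf : ∀ e, a₃ ∈ ends e → e = f)
    (hx : x = o ∨ x = b ∨ x = a₁ ∨ x = a₂) (h31 : a₃ ≠ a₁) (h32 : a₃ ≠ a₂) (ho : o ≠ a₃)
    (hb : b ≠ a₃) : HCov p ends o a₁ a₂ a₃ b :=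
  HCov_of_a3Between hp ends o a₁ a₂ a₃ b (A3Between_pendant_mark hp hf hleaf hx h31 h32 ho hb)

end A3Fibre

end CovForm

end Summit.Ventures.PercRepro2
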